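import Summits.ValiantsHypothesis.ValiantsHypothesis.Theorems.LacunarySymmetroidMatrixDescartesPivotRankOneCriticalWindowsSeparation
import Summits.ValiantsHypothesis.ValiantsHypothesis.Theorems.LacunarySymmetroidMatrixDescartesPivotRankOneCriticalWindowsRootCountLone

/-!
# `MatrixDescartes` census — rank-one `(2,K)₁`: THE ROOT COUNT LOCALISES TO ONE SIDE
# (`Z₊(det F) ≤ 1 + max(C_L, C_R)`; the MIDDLE-PIVOT LAW `Z₊ ≤ 3` at `K = 3`)

HONEST FRAMING.  Object-search cell `pub-symmetroid`, seat `val-sym-mdr-p1` (generation 25); helper file `--supports` the crux item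
stmt-ValiantsHypothesis-18050 (`Theses.LacunarySymmetroid.MatrixDescartes`, OPEN, on HOLD) with NO closure claim.  COUNTS for the `1|K−1`
rank-one hyperbolic row (`F(x) = x^e[[0,1],[1,0]] + ∑ₖ wₖx^{dₖ}(1,tₖ)(1,tₖ)ᵀ`, one letter `p` with `dₚ < e`, the others with `dₖ > e`), obtained
by combining the pipeline `…CriticalWindowsRootCount` (Rolle), the separation theorem `…CriticalWindowsSeparation` (the positive roots never
straddle a pivot-direction scale) and the lone-letter budgets `…CriticalWindowsRootCountLone` (p698043).  Nothing here bears on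
`MatrixDescartes` in its window, on `DoorA26` / `DoorA34`, registers / credences, or `VP ≠ VNP`; the rank-one register is unchanged.

MAIN THEOREMS.
* §1 `card_posRoots_le_card_add_one_of_between` — the tree's Rolle count (`…PivotResolventRolle`) with the membership hypothesis required only
  for critical points lying strictly BETWEEN two positive roots.
* §2 **`rankOne_card_posRoots_le_max_add_one`** — THE LOCALISED PIPELINE: with side budgets `C_L`, `C_R` for the critical points of the window
  profile (as in `RootCount.rankOne_card_posRoots_le_of_sideBudgets`), **`Z₊(f) ≤ max(C_L, C_R) + 1`**.  Proof: the optimal direction `T̂`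
  is continuous and never equals `tₚ` between the smallest and the largest positive root (else the roots would straddle a pivot-direction
  scale — `Separation.not_straddle_pivotScale`), so by the intermediate value theorem every Rolle point between two roots lies on ONE side.
* §3 **`rankOne_card_posRoots_le_three_of_middle`** — THE MIDDLE-PIVOT LAW: three letters `p, i, j` with `tᵢ < tₚ < tⱼ` (the pivot letter's
  position between the other two), `dₚ < e < dᵢ, dⱼ`, any positive weights: **`Z₊ ≤ 3`** (both sides have budget two by the lone-letter law).
  With `…PivotRankOneThree` (the rank-one `(2,3)₁` row is `≤ 5`, and `5` is attained — by an object whose two upper letters lie on ONE side of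
  the pivot letter) this splits the row by position order: middle pivot `≤ 3`, outer pivot `5`.  Census currency (§4):
  **`pivotPosRoots_le_max_add_one`**, **`pivotPosRoots_le_three_of_middle`**.
* Also §2 `rankOne_card_posRoots_le_max_three_of_lone_right`: a lone letter beyond the pivot letter ⇒ `Z₊ ≤ max(C_L, 2) + 1`.

[folklore] Rolle (`exists_hasDerivAt_eq_zero`), the intermediate value theorem (`intermediate_value_Icc`/`_Icc'`), continuity of fewnomials and
`Real.sqrt`; tree theorems named above.  No definitions, no named facts.
-/

-- `Summit.ValiantsHypothesis.ValiantsHypothesis.…` repeats a component by the D-0017 layout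
-- (single-conjunct summit), which the `dupNamespace` linter flags; the name is mandated.
set_option linter.dupNamespace false

namespace Summit.ValiantsHypothesis.ValiantsHypothesis.Theorems.LacunarySymmetroidMatrixDescartes.Pivot.CriticalWindows.SideCount

open Polynomial Finset Set Matrix
open scoped BigOperators
open Summit.ValiantsHypothesis.ValiantsHypothesis.Theorems.LacunarySymmetroidMatrixDescartes.Pivot (pivotPosRoots)
open Summit.ValiantsHypothesis.ValiantsHypothesis.Theorems.LacunarySymmetroidMatrixDescartes.Pivot.CriticalWindows.RootCount
open Summit.ValiantsHypothesis.ValiantsHypothesis.Theorems.LacunarySymmetroidMatrixDescartes.Pivot.CriticalWindows.Separation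
  (not_straddle_pivotScale)

/-! ## 1. Rolle count with the membership hypothesis only between roots -/

/-- **ROLLE COUNT (between-roots form).**  As `…PivotResolventRolle.card_posRoots_le_card_add_one`, but the finite set `T` need only contain
the critical points `c` of `φ` that lie strictly between two positive roots of `f`. [folklore] -/
theorem card_posRoots_le_card_add_one_of_between (f : ℝ[X]) (φ φ' : ℝ → ℝ)
    (hφ : ∀ x, 0 < x → (φ x = 0 ↔ f.IsRoot x)) (hder : ∀ x, 0 < x → HasDerivAt φ (φ' x) x)
    (T : Finset ℝ) (hT : ∀ c, 0 < c → φ' c = 0 →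
      (∃ a b, a ∈ f.roots.toFinset.filter (fun t => 0 < t) ∧ b ∈ f.roots.toFinset.filter (fun t => 0 < t) ∧ a < c ∧ c < b) → c ∈ T) :
    (f.roots.toFinset.filter (fun t => 0 < t)).card ≤ T.card + 1 := by
  classical
  set S := f.roots.toFinset.filter (fun t => 0 < t) with hS
  obtain ⟨n, hn⟩ : ∃ n, S.card = n := ⟨_, rfl⟩
  rw [hn]
  set r := S.orderEmbOfFin hn with hr
  have hrS : ∀ j, r j ∈ S := fun j => Finset.orderEmbOfFin_mem _ _ _
  have hrpos : ∀ j, 0 < r j := fun j => (Finset.mem_filter.1 (hrS j)).2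
  have hrroot : ∀ j, f.IsRoot (r j) := fun j => by
    have h := (Finset.mem_filter.1 (hrS j)).1
    rw [Multiset.mem_toFinset] at h
    exact isRoot_of_mem_roots h
  have hmono : ∀ i j : Fin n, (i : ℕ) < j → r i < r j := fun i j h => r.strictMono (Fin.lt_def.2 h)
  have hex : ∀ i : Fin (n - 1), ∃ c, r ⟨i, by omega⟩ < c ∧ c < r ⟨i + 1, by omega⟩ ∧ φ' c = 0 := by
    intro i
    have hlt : r ⟨i, by omega⟩ < r ⟨i + 1, by omega⟩ := hmono _ _ (by simp)
    have ha : 0 < r ⟨i, by omega⟩ := hrpos _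
    have hcont : ContinuousOn φ (Icc (r ⟨i, by omega⟩) (r ⟨i + 1, by omega⟩)) := by
      intro x hx
      exact (hder x (lt_of_lt_of_le ha hx.1)).continuousAt.continuousWithinAt
    have hends : φ (r ⟨i, by omega⟩) = φ (r ⟨i + 1, by omega⟩) := by
      rw [(hφ _ ha).2 (hrroot _), (hφ _ (hrpos _)).2 (hrroot _)]
    obtain ⟨c, hc, hc0⟩ := exists_hasDerivAt_eq_zero (f := φ) (f' := φ') hlt hcont hends
      (fun x hx => hder x (ha.trans hx.1))
    exact ⟨c, hc.1, hc.2, hc0⟩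
  choose c hc using hex
  have hcT : ∀ i : Fin (n - 1), c i ∈ T := fun i =>
    hT (c i) ((hrpos _).trans (hc i).1) (hc i).2.2 ⟨_, _, hrS _, hrS _, (hc i).1, (hc i).2.1⟩
  have hcmono : StrictMono c := by
    intro i j hij
    have hij' : (i : ℕ) + 1 ≤ j := by
      have := Fin.lt_def.1 hij
      omega
    calc c i < r ⟨i + 1, by omega⟩ := (hc i).2.1
      _ ≤ r ⟨j, by omega⟩ := r.monotone (Fin.le_def.2 hij')
      _ < c j := (hc j).1
  have hcard : (Finset.univ : Finset (Fin (n - 1))).card ≤ T.card :=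
    Finset.card_le_card_of_injOn c (fun i _ => hcT i) (hcmono.injective.injOn)
  rw [Finset.card_univ, Fintype.card_fin] at hcard
  omega

/-! ## 2. The localised pipeline: `Z₊ ≤ max(C_L, C_R) + 1` -/

/-- Continuity of the optimal direction `T̂(x) = √(C(x)/A(x))` on `(0,∞)`. [folklore] -/
theorem continuousAt_optDir {ι : Type*} (s : Finset ι) (hs : s.Nonempty) (w t : ι → ℝ) (d : ι → ℕ)
    (hw : ∀ m ∈ s, 0 < w m) (ht : ∀ m ∈ s, 0 < t m) {x : ℝ} (hx : 0 < x) :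
    ContinuousAt (fun y => Real.sqrt ((∑ k ∈ s, w k * t k ^ 2 * y ^ d k) / ∑ k ∈ s, w k * y ^ d k)) x := by
  obtain ⟨hA, -, -⟩ := moments_pos s hs w t d hw ht hx
  have hcA : ContinuousAt (fun y => ∑ k ∈ s, w k * y ^ d k) x :=
    (continuous_finsetSum s fun k _ => (continuous_const.mul (continuous_pow (d k)))).continuousAt
  have hcC : ContinuousAt (fun y => ∑ k ∈ s, w k * t k ^ 2 * y ^ d k) x :=
    (continuous_finsetSum s fun k _ => (continuous_const.mul (continuous_pow (d k)))).continuousAt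
  exact (hcC.div hcA hA.ne').sqrt

/-- **THE LOCALISED PIPELINE.**  In the setting of `RootCount.rankOne_card_posRoots_le_of_sideBudgets` (positive weights and positions,
`dₚ < e < dₘ` off the pivot letter, not all letters parallel, `f` with positive roots the positive zeros of `A C − (U + x^e)²`, side budgets
`C_L`, `C_R` for the scales carrying left / right critical points of the window profile): **`Z₊(f) ≤ max(C_L, C_R) + 1`**.  Between the
smallest and the largest positive root the optimal direction `T̂` never equals `tₚ` (`Separation.not_straddle_pivotScale`), so by
continuity it stays on ONE side there, and so do all Rolle points. [this file] -/
theorem rankOne_card_posRoots_le_max_add_one {ι : Type*} (s : Finset ι) (w t : ι → ℝ) (d : ι → ℕ) (e : ℕ) (p : ι)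
    (hp : p ∈ s) (hw : ∀ m ∈ s, 0 < w m) (ht : ∀ m ∈ s, 0 < t m) (hdp : d p < e) (hdm : ∀ m ∈ s, m ≠ p → e < d m)
    (hnp : ∃ m ∈ s, t m ≠ t p) (f : ℝ[X])
    (hf : ∀ x, 0 < x → (f.IsRoot x ↔ (∑ k ∈ s, w k * x ^ d k) * (∑ k ∈ s, w k * t k ^ 2 * x ^ d k)
      - ((∑ k ∈ s, w k * t k * x ^ d k) + x ^ e) ^ 2 = 0))
    (CL CR : ℕ)
    (hL : ∀ S : Finset ℝ, (∀ x ∈ S, 0 < x ∧ ∃ T, 0 < T ∧ T < t p ∧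
        (∑ m ∈ s, w m * x ^ d m * (T ^ 2 - t m ^ 2) = 0) ∧
        (∑ m ∈ s, ((d m : ℝ) - e) * (w m * x ^ d m) * (T - t m) ^ 2 = 0)) → S.card ≤ CL)
    (hR : ∀ S : Finset ℝ, (∀ x ∈ S, 0 < x ∧ ∃ T, t p < T ∧
        (∑ m ∈ s, w m * x ^ d m * (T ^ 2 - t m ^ 2) = 0) ∧
        (∑ m ∈ s, ((d m : ℝ) - e) * (w m * x ^ d m) * (T - t m) ^ 2 = 0)) → S.card ≤ CR) :
    (f.roots.toFinset.filter (fun t => 0 < t)).card ≤ max CL CR + 1 := by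
  classical
  have hs : s.Nonempty := ⟨p, hp⟩
  -- the optimal direction and the gap profile, as in the pipeline file
  set τ : ℝ → ℝ := fun x => Real.sqrt ((∑ k ∈ s, w k * t k ^ 2 * x ^ d k) / (∑ k ∈ s, w k * x ^ d k)) with hτdef
  have hτpos : ∀ x, 0 < x → 0 < τ x := by
    intro x hx
    obtain ⟨hA, -, hC⟩ := moments_pos s hs w t d hw ht hx
    exact Real.sqrt_pos.2 (div_pos hC hA)
  have hτC : ∀ x, 0 < x → (∑ k ∈ s, w k * x ^ d k) * τ x ^ 2 = ∑ k ∈ s, w k * t k ^ 2 * x ^ d k := by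
    intro x hx
    obtain ⟨hA, -, hC⟩ := moments_pos s hs w t d hw ht hx
    rw [hτdef, Real.sq_sqrt (div_pos hC hA).le]
    field_simp
  have hE1 : ∀ x, 0 < x → ∑ m ∈ s, w m * x ^ d m * (τ x ^ 2 - t m ^ 2) = 0 := by
    intro x hx
    have h := hτC x hx
    have : ∑ m ∈ s, w m * x ^ d m * (τ x ^ 2 - t m ^ 2)
        = (∑ k ∈ s, w k * x ^ d k) * τ x ^ 2 - ∑ k ∈ s, w k * t k ^ 2 * x ^ d k := by
      rw [Finset.sum_mul, ← Finset.sum_sub_distrib]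
      exact Finset.sum_congr rfl fun k _ => by ring
    rw [this, h, sub_self]
  -- pivot-direction scales: τ x = t_p gives the `hstar` relation
  have hstar_of : ∀ x, 0 < x → τ x = t p → ∑ k ∈ s, w k * x ^ d k * (t k ^ 2 - t p ^ 2) = 0 := by
    intro x hx hτx
    have h := hE1 x hx
    rw [hτx] at h
    have : ∑ k ∈ s, w k * x ^ d k * (t k ^ 2 - t p ^ 2) = -∑ m ∈ s, w m * x ^ d m * (t p ^ 2 - t m ^ 2) := by
      rw [← Finset.sum_neg_distrib]; exact Finset.sum_congr rfl fun k _ => by ring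
    rw [this, h, neg_zero]
  set φ : ℝ → ℝ := fun y => (Real.sqrt ((∑ k ∈ s, w k * y ^ d k) * (∑ k ∈ s, w k * t k ^ 2 * y ^ d k))
      - ∑ k ∈ s, w k * t k * y ^ d k) / y ^ e - 1 with hφdef
  set φ' : ℝ → ℝ := fun x => (∑ k ∈ s, ((d k : ℝ) - e) * (w k * x ^ d k) * (τ x - t k) ^ 2) / (2 * τ x * x ^ (e + 1))
    with hφ'def
  have hφ : ∀ x, 0 < x → (φ x = 0 ↔ f.IsRoot x) := by
    intro x hx
    obtain ⟨hA, hU, hC⟩ := moments_pos s hs w t d hw ht hx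
    rw [hf x hx, hφdef]
    exact gapProfile_eq_zero_iff _ _ _ _ (mul_pos hA hC).le (add_pos hU (pow_pos hx e)).le (pow_pos hx e)
  have hder : ∀ x, 0 < x → HasDerivAt φ (φ' x) x := fun x hx =>
    hasDerivAt_gapProfile s hs w t d e hw ht hx (hτpos x hx) (hτC x hx)
  have hE2 : ∀ c, 0 < c → φ' c = 0 → ∑ m ∈ s, ((d m : ℝ) - e) * (w m * c ^ d m) * (τ c - t m) ^ 2 = 0 := by
    intro c hc h0
    rw [hφ'def, div_eq_zero_iff] at h0
    rcases h0 with h0 | h0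
    · exact h0
    · exact absurd h0 (mul_pos (mul_pos two_pos (hτpos c hc)) (pow_pos hc _)).ne'
  -- a root gives the gap equation √(AC) − U = x^e
  have hroot_gap : ∀ x, 0 < x → f.IsRoot x →
      Real.sqrt ((∑ k ∈ s, w k * x ^ d k) * (∑ k ∈ s, w k * t k ^ 2 * x ^ d k)) - ∑ k ∈ s, w k * t k * x ^ d k = x ^ e := by
    intro x hx hr
    have h := (hφ x hx).2 hr
    rw [hφdef] at h
    have hxe : x ^ e ≠ 0 := (pow_pos hx e).ne'
    have h' : (Real.sqrt ((∑ k ∈ s, w k * x ^ d k) * (∑ k ∈ s, w k * t k ^ 2 * x ^ d k))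
        - ∑ k ∈ s, w k * t k * x ^ d k) / x ^ e = 1 := by linarith
    rwa [div_eq_one_iff_eq hxe] at h'
  -- the finite critical sets on each side
  set critL : Set ℝ := {c | 0 < c ∧ φ' c = 0 ∧ τ c < t p} with hcritL
  set critR : Set ℝ := {c | 0 < c ∧ φ' c = 0 ∧ t p < τ c} with hcritR
  have hmemL : ∀ S : Finset ℝ, (∀ c ∈ S, c ∈ critL) → S.card ≤ CL := fun S hS =>
    hL S fun x hx => ⟨(hS x hx).1, τ x, hτpos x (hS x hx).1, (hS x hx).2.2, hE1 x (hS x hx).1, hE2 x (hS x hx).1 (hS x hx).2.1⟩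
  have hmemR : ∀ S : Finset ℝ, (∀ c ∈ S, c ∈ critR) → S.card ≤ CR := fun S hS =>
    hR S fun x hx => ⟨(hS x hx).1, τ x, (hS x hx).2.2, hE1 x (hS x hx).1, hE2 x (hS x hx).1 (hS x hx).2.1⟩
  have hfinL : critL.Finite := by
    by_contra hinf
    obtain ⟨S, hS, hcard⟩ := Set.Infinite.exists_subset_card_eq hinf (CL + 1)
    have := hmemL S fun c hc => hS hc
    omega
  have hfinR : critR.Finite := by
    by_contra hinf
    obtain ⟨S, hS, hcard⟩ := Set.Infinite.exists_subset_card_eq hinf (CR + 1)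
    have := hmemR S fun c hc => hS hc
    omega
  have hcardL : hfinL.toFinset.card ≤ CL := hmemL _ fun c hc => by simpa using hc
  have hcardR : hfinR.toFinset.card ≤ CR := hmemR _ fun c hc => by simpa using hc
  -- KEY: between two positive roots the optimal direction stays on the side it has at the smaller root
  have hside : ∀ a b c, 0 < a → f.IsRoot a → f.IsRoot b → a < c → c < b → (τ c < t p ↔ τ a < t p) := by
    intro a b c ha hra hrb hac hcb
    have hb : 0 < b := ha.trans (hac.trans hcb)
    have hc : 0 < c := ha.trans hac
    -- no pivot-direction scale in [a, b]
    have hno : ∀ y, a ≤ y → y ≤ b → τ y ≠ t p := by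
      intro y hay hyb hτy
      have hy : 0 < y := lt_of_lt_of_le ha hay
      have h := not_straddle_pivotScale s w t d e p hp hw ht hdm hnp ha hay hyb (hstar_of y hy hτy)
        (hroot_gap a ha hra) (hroot_gap b hb hrb)
      exact absurd h (hac.trans hcb).ne
    have hcont : ContinuousOn τ (Icc a c) := fun y hy =>
      (continuousAt_optDir s hs w t d hw ht (lt_of_lt_of_le ha hy.1)).continuousWithinAt
    constructor
    · intro hτc
      by_contra hτa
      push Not at hτa
      rcases hτa.lt_or_eq with hlt | heq
      · -- τ a > t_p > τ c : IVT on [a, c]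
        obtain ⟨y, hy, hτy⟩ := intermediate_value_Icc' hac.le hcont ⟨hτc.le, hlt.le⟩
        exact hno y hy.1 (hy.2.trans hcb.le) hτy
      · exact hno a le_rfl (hac.trans hcb).le heq.symm
    · intro hτa
      by_contra hτc
      push Not at hτc
      rcases hτc.lt_or_eq with hlt | heq
      · obtain ⟨y, hy, hτy⟩ := intermediate_value_Icc hac.le hcont ⟨hτa.le, hlt.le⟩
        exact hno y hy.1 (hy.2.trans hcb.le) hτy
      · exact hno c hac.le hcb.le heq.symm
  -- case analysis on the side of the smallest positive root (if any)
  set Sroots := f.roots.toFinset.filter (fun t => 0 < t) with hSroots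
  by_cases hne : Sroots.Nonempty
  · set a₀ := Sroots.min' hne with ha₀
    have ha₀mem : a₀ ∈ Sroots := Finset.min'_mem _ _
    have ha₀pos : 0 < a₀ := (Finset.mem_filter.1 ha₀mem).2
    have ha₀root : f.IsRoot a₀ := by
      have h := (Finset.mem_filter.1 ha₀mem).1
      rw [Multiset.mem_toFinset] at h
      exact isRoot_of_mem_roots h
    have hmemS : ∀ a, a ∈ Sroots → 0 < a ∧ f.IsRoot a := by
      intro a ha
      have h := Finset.mem_filter.1 ha
      rw [Multiset.mem_toFinset] at h
      exact ⟨h.2, isRoot_of_mem_roots h.1⟩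
    -- the side of a Rolle point between two roots of S equals the side at the smallest root a₀
    have hside₀ : ∀ a b c, a ∈ Sroots → b ∈ Sroots → a < c → c < b → (τ c < t p ↔ τ a₀ < t p) := by
      intro a b c haS hbS hac hcb
      obtain ⟨ha, hra⟩ := hmemS a haS
      obtain ⟨-, hrb⟩ := hmemS b hbS
      have hle : a₀ ≤ a := Finset.min'_le _ _ haS
      rw [hside a b c ha hra hrb hac hcb]
      rcases hle.lt_or_eq with hlt | heq
      · exact hside a₀ b a ha₀pos ha₀root hrb hlt (hac.trans hcb)
      · rw [heq]
    rcases lt_or_ge (τ a₀) (t p) with hlt | hge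
    · -- all Rolle points are LEFT critical points
      have h := card_posRoots_le_card_add_one_of_between f φ φ' hφ hder hfinL.toFinset fun c hc h0 hbetween => by
        obtain ⟨a, b, haS, hbS, hac, hcb⟩ := hbetween
        have hcL : τ c < t p := (hside₀ a b c haS hbS hac hcb).2 hlt
        simpa [hcritL] using And.intro hc (And.intro h0 hcL)
      calc (f.roots.toFinset.filter (fun t => 0 < t)).card ≤ hfinL.toFinset.card + 1 := h
        _ ≤ CL + 1 := by omega
        _ ≤ max CL CR + 1 := by gcongr; exact le_max_left _ _
    · -- all Rolle points are RIGHT critical points (τ ≠ t_p at a critical point)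
      have h := card_posRoots_le_card_add_one_of_between f φ φ' hφ hder hfinR.toFinset fun c hc h0 hbetween => by
        obtain ⟨a, b, haS, hbS, hac, hcb⟩ := hbetween
        have hcL : ¬ τ c < t p := fun h' => absurd ((hside₀ a b c haS hbS hac hcb).1 h') (not_lt.2 hge)
        have hde : ∀ m ∈ s, d m ≠ e := by
          intro m hm
          by_cases hmp : m = p
          · rw [hmp]; exact hdp.ne
          · exact (hdm m hm hmp).ne'
        have hcne : τ c ≠ t p := by
          intro hτc
          obtain ⟨m, hm, hmt⟩ := hnp
          exact hmt (ne_pivot_of_critical s w t d e p hw hdm hc (hE2 c hc h0) hτc m hm)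
        have hcR : t p < τ c := lt_of_le_of_ne (not_lt.1 hcL) (Ne.symm hcne)
        simpa [hcritR] using And.intro hc (And.intro h0 hcR)
      calc (f.roots.toFinset.filter (fun t => 0 < t)).card ≤ hfinR.toFinset.card + 1 := h
        _ ≤ CR + 1 := by omega
        _ ≤ max CL CR + 1 := by gcongr; exact le_max_right _ _
  · rw [Finset.not_nonempty_iff_eq_empty] at hne
    rw [hne, Finset.card_empty]
    omega

/-- **LONE LETTER BEYOND THE PIVOT ⇒ `Z₊ ≤ max(C_L, 2) + 1`.** [this file + `RootCount.lone_right_budget`] -/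
theorem rankOne_card_posRoots_le_max_three_of_lone_right {ι : Type*} (s : Finset ι) (w t : ι → ℝ) (d : ι → ℕ) (e : ℕ) (p j : ι)
    (hp : p ∈ s) (hj : j ∈ s) (hpj : p ≠ j) (hleft : ∃ m ∈ s, m ≠ p ∧ m ≠ j)
    (hw : ∀ m ∈ s, 0 < w m) (ht : ∀ m ∈ s, 0 < t m) (hdp : d p < e) (hdm : ∀ m ∈ s, m ≠ p → e < d m)
    (htp : ∀ m ∈ s, m ≠ p → m ≠ j → t m < t p) (hpj' : t p < t j) (f : ℝ[X])
    (hf : ∀ x, 0 < x → (f.IsRoot x ↔ (∑ k ∈ s, w k * x ^ d k) * (∑ k ∈ s, w k * t k ^ 2 * x ^ d k)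
      - ((∑ k ∈ s, w k * t k * x ^ d k) + x ^ e) ^ 2 = 0))
    (CL : ℕ)
    (hL : ∀ S : Finset ℝ, (∀ x ∈ S, 0 < x ∧ ∃ T, 0 < T ∧ T < t p ∧
        (∑ m ∈ s, w m * x ^ d m * (T ^ 2 - t m ^ 2) = 0) ∧
        (∑ m ∈ s, ((d m : ℝ) - e) * (w m * x ^ d m) * (T - t m) ^ 2 = 0)) → S.card ≤ CL) :
    (f.roots.toFinset.filter (fun t => 0 < t)).card ≤ max CL 2 + 1 :=
  rankOne_card_posRoots_le_max_add_one s w t d e p hp hw ht hdp hdm ⟨j, hj, hpj'.ne'⟩ f hf CL 2 hL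
    (lone_right_budget s w t d e p j hp hj hpj hleft hw ht hdp hdm htp hpj')

/-! ## 3. The middle-pivot law at `K = 3` -/

/-- **THE MIDDLE-PIVOT LAW.**  Three letters `p, i, j` (the two «all others on the far side» hypotheses exclude any further letter), the
pivot letter's position BETWEEN the other two (`tᵢ < tₚ < tⱼ`), `dₚ < e < dᵢ, dⱼ`, any positive weights, `f` with positive roots the
positive zeros of `det F = A C − (U + x^e)²`: **`Z₊(f) ≤ 3`**.  (Both sides have budget two by the lone-letter law; the count localises to
one side.  The rank-one `(2,3)₁` FIVE of `…PivotRankOneThree` has both upper letters on ONE side of the pivot letter.) [this file] -/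
theorem rankOne_card_posRoots_le_three_of_middle {ι : Type*} (s : Finset ι) (w t : ι → ℝ) (d : ι → ℕ) (e : ℕ) (p i j : ι)
    (hp : p ∈ s) (hi : i ∈ s) (hj : j ∈ s) (hpi : p ≠ i) (hpj : p ≠ j) (hij : i ≠ j)
    (hw : ∀ m ∈ s, 0 < w m) (ht : ∀ m ∈ s, 0 < t m) (hdp : d p < e) (hdm : ∀ m ∈ s, m ≠ p → e < d m)
    (hleft : ∀ m ∈ s, m ≠ p → m ≠ j → t m < t p) (hright : ∀ m ∈ s, m ≠ p → m ≠ i → t p < t m)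
    (hip : t i < t p) (hpj' : t p < t j) (f : ℝ[X])
    (hf : ∀ x, 0 < x → (f.IsRoot x ↔ (∑ k ∈ s, w k * x ^ d k) * (∑ k ∈ s, w k * t k ^ 2 * x ^ d k)
      - ((∑ k ∈ s, w k * t k * x ^ d k) + x ^ e) ^ 2 = 0)) :
    (f.roots.toFinset.filter (fun t => 0 < t)).card ≤ 3 :=
  rankOne_card_posRoots_le_max_add_one s w t d e p hp hw ht hdp hdm ⟨j, hj, hpj'.ne'⟩ f hf 2 2
    (lone_left_budget s w t d e p i hp hi hpi ⟨j, hj, hpj.symm, hij.symm⟩ hw ht hdp hdm hright hip)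
    (lone_right_budget s w t d e p j hp hj hpj ⟨i, hi, hpi.symm, hij⟩ hw ht hdp hdm hleft hpj')

/-! ## 4. Census currency -/

/-- **THE LOCALISED PIPELINE IN CENSUS CURRENCY**: `pivotPosRoots e d J P ≤ max(C_L, C_R) + 1` for the hyperbolic normal form with `Fin K`
rank-one letters. [this file] -/
theorem pivotPosRoots_le_max_add_one (K e : ℕ) (d : Fin K → ℕ) (w t : Fin K → ℝ) (p : Fin K)
    (hw : ∀ m, 0 < w m) (ht : ∀ m, 0 < t m) (hdp : d p < e) (hdm : ∀ m, m ≠ p → e < d m) (hnp : ∃ m, t m ≠ t p) (CL CR : ℕ)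
    (hL : ∀ S : Finset ℝ, (∀ x ∈ S, 0 < x ∧ ∃ T, 0 < T ∧ T < t p ∧
        (∑ m, w m * x ^ d m * (T ^ 2 - t m ^ 2) = 0) ∧
        (∑ m, ((d m : ℝ) - e) * (w m * x ^ d m) * (T - t m) ^ 2 = 0)) → S.card ≤ CL)
    (hR : ∀ S : Finset ℝ, (∀ x ∈ S, 0 < x ∧ ∃ T, t p < T ∧
        (∑ m, w m * x ^ d m * (T ^ 2 - t m ^ 2) = 0) ∧
        (∑ m, ((d m : ℝ) - e) * (w m * x ^ d m) * (T - t m) ^ 2 = 0)) → S.card ≤ CR) :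
    pivotPosRoots e d (!![(0 : ℝ), 1; 1, 0]) (fun k => w k • vecMulVec ![1, t k] ![1, t k]) ≤ max CL CR + 1 := by
  unfold pivotPosRoots
  refine rankOne_card_posRoots_le_max_add_one (Finset.univ : Finset (Fin K)) w t d e p (Finset.mem_univ p)
    (fun m _ => hw m) (fun m _ => ht m) hdp (fun m _ hm => hdm m hm) ?_ _ ?_ CL CR ?_ ?_
  · obtain ⟨m, hm⟩ := hnp
    exact ⟨m, Finset.mem_univ m, hm⟩
  · intro x hx
    rw [Polynomial.IsRoot.def, det_rankOne_hyperbolic_eval]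
  · intro S hS
    exact hL S fun x hx => hS x hx
  · intro S hS
    exact hR S fun x hx => hS x hx

/-- **THE MIDDLE-PIVOT LAW IN CENSUS CURRENCY**: `Fin K` letters with the two lone hypotheses (hence `K = 3` in substance), the pivot letter's
position between the other two ⇒ `pivotPosRoots ≤ 3`. [this file] -/
theorem pivotPosRoots_le_three_of_middle (K e : ℕ) (d : Fin K → ℕ) (w t : Fin K → ℝ) (p i j : Fin K)
    (hpi : p ≠ i) (hpj : p ≠ j) (hij : i ≠ j) (hw : ∀ m, 0 < w m) (ht : ∀ m, 0 < t m) (hdp : d p < e)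
    (hdm : ∀ m, m ≠ p → e < d m) (hleft : ∀ m, m ≠ p → m ≠ j → t m < t p) (hright : ∀ m, m ≠ p → m ≠ i → t p < t m)
    (hip : t i < t p) (hpj' : t p < t j) :
    pivotPosRoots e d (!![(0 : ℝ), 1; 1, 0]) (fun k => w k • vecMulVec ![1, t k] ![1, t k]) ≤ 3 := by
  have h := pivotPosRoots_le_max_add_one K e d w t p hw ht hdp hdm ⟨j, hpj'.ne'⟩ 2 2
    (lone_left_budget Finset.univ w t d e p i (Finset.mem_univ p) (Finset.mem_univ i) hpi
      ⟨j, Finset.mem_univ j, hpj.symm, hij.symm⟩ (fun m _ => hw m) (fun m _ => ht m) hdp (fun m _ hm => hdm m hm)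
      (fun m _ h1 h2 => hright m h1 h2) hip)
    (lone_right_budget Finset.univ w t d e p j (Finset.mem_univ p) (Finset.mem_univ j) hpj
      ⟨i, Finset.mem_univ i, hpi.symm, hij⟩ (fun m _ => hw m) (fun m _ => ht m) hdp (fun m _ hm => hdm m hm)
      (fun m _ h1 h2 => hleft m h1 h2) hpj')
  simpa using h

end Summit.ValiantsHypothesis.ValiantsHypothesis.Theorems.LacunarySymmetroidMatrixDescartes.Pivot.CriticalWindows.SideCount
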